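import Summits.HodgeConjecture.HodgeConjecture.Theorems.F0P6aStubRHO1DockFold
import HarnessLib

/-!
# `F0P6aStubRHO1Rho1Rows` — ★ RE-HOME of `Lines/F0_P6a_StubRHO1.lean` (tree sha16 ce86702e556aed39, 1561 l.), PART 4 of 6 — tree lines :862–:1197
See PART 1 `Theorems/F0P6aStubRHO1K4Seam.lean` for the full ★ re-home header and the original module docstring (verbatim there).  Same namespace (every
fully-qualified name unchanged); the scopes open at the cut are re-opened below with their `variable` ∕ `open` ∕ `set_option` ∕ `universe` lines replayed verbatim
from the tree, in order; the code after the replay block is the tree bytes :862–:1197, untouched except the (d1) cure named in PART 1.  HC_CM is proved only modulo the 7 printed citations (2 remaining: hLiu418 = stmt-HodgeConjecture-24832, h413 = stmt-HodgeConjecture-24833) until rung 0 closes; a re-home is count-neutral.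
-/

-- ── replay of the scopes open at tree line :862 (verbatim) ──
set_option autoImplicit false
set_option linter.dupNamespace false
noncomputable section
namespace Summit.HodgeConjecture.HodgeConjecture.Cruxes.HLiu418.F0P6aLineSpecialisation
open CategoryTheory CategoryTheory.Limits NumberField IsDedekindDomain MulAction AlgebraicGeometry
open scoped Matrix Polynomial Pointwise MonoidalCategory
open Literature.NumberTheory.GaloisRepresentations
open Literature.NumberTheory.Automorphic Literature.NumberTheory.Automorphic.UnitaryGroup
open Literature.AlgebraicGeometry.ShimuraVarieties.UnitaryCanonicalModel
open Literature.NumberTheory.Automorphic.Liu2021.AppendixC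
open Literature.AlgebraicGeometry.Motives (AlgPoints IntegralModel SchemeOver thickening thickeningGalAction thickeningLift specOver extendPoint
  specValuationSubring specFractionFieldι specRingHomι)
open Literature.NumberTheory.EllipticCurves (genericFibre specGenericPoint)
open Literature.NumberTheory.DiophantineGeometry (geomResidueField specialFibreFunctor specResidueField geomClosedPointIsoSpecResidueField
  toClosureValuationSubring)
open Literature.AlgebraicGeometry.RelativeSpec (ActionOver)
open Literature.AlgebraicGeometry.AbelianSchemes Literature.AlgebraicGeometry.AbelianSchemes.AbelianSchemeOver
open Literature.AlgebraicGeometry.GroupSchemes.AffineGroupScheme (Alg quotIncl)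
open Summit.HodgeConjecture.HodgeConjecture.Cruxes.HLiu418.F0P6aModuliDatumDefs
open Summit.HodgeConjecture.HodgeConjecture.Cruxes.HLiu418.F0P6aRGDAssembly
open Summit.HodgeConjecture.HodgeConjecture.Cruxes.HLiu418.F0P6aDatumOfInputs
section Rho1Head
open scoped MonObj CategoryTheory.Obj
variable {F : Type} [Field F] [NumberField F] [IsCMField F] [IsGalois ℚ F] {ι₁ : F →+* ℂ}
    {Jstar : Matrix (Fin 2) (Fin 2) F}
    {K₀ : C5.OpenCompactSubgroup ↥(finAdelic ↥(maximalRealSubfield F) F (IsCMField.complexConj F) 2 Jstar)}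
    {S : RecordSystemGS F Jstar ι₁ K₀} {hU7ₛ : S.HeckeTranslateDefinedOver}
    {hJ : (Jstar.map (IsCMField.complexConj F))ᵀ = Jstar} {hJu : IsUnit Jstar}
    {Fi : Type} [Field Fi] [Algebra F Fi] {Kc : C5.SmallLevel K₀} {G : Type} [Group G]
    {𝓜 : IntegralModel (𝓞 F) F ((thickening F Fi).obj (S.M.obj Kc))}
    {w : HeightOneSpectrum (𝓞 F)} {hw : (IsCMField.complexConj F) • w ≠ w} {h𝓨 : (𝓜.localise w).IsSmoothProper 1}
    {θ : ActionOver (𝓜.localise w).total.hom ((Fi ≃ₐ[F] Fi) × G)}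
    {e : Fi →ₐ[F] AlgebraicClosure (w.adicCompletion F)}
set_option backward.isDefEq.respectTransparency false
set_option linter.unusedSectionVars false

set_option maxHeartbeats 400000 in
set_option backward.isDefEq.respectTransparency false in
/-- **(ρ1𝒞) v6 §J ROWS A — PIECE 1∕2: (mon)(FLAT-SURJ)(ACT)(LVL)(SIM)** («ROWSA-SPLIT», LA1-plan (g5) 2026-09-02T16:20:34Z ∕ 16:32:41Z (T1)(T2); LA1-p02 (g5)): the `∃ (_ : IsMonHom ψ)` witness and the first four conjuncts of
`rho1_rowsA_of_leg` (texts VERBATIM at `ψ := qb`) from the leg's (r1₀)(r4₀)(r5₀)(r3₀ ∀) row BINDERS `hm hFLAT hACT hLVL hSIM` (texts VERBATIM); binders pruned to what these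
rows read (no `translΩ`∕roof letters∕`K`∕`q`∕`c`); one `subst hq`; the monoid-hom witness is transported through two `GrpObj` `rfl`-pins (see the body comment). [cite: Liu2021, Prop. D.8 (3) p. 135, pp. 136–138] [cite: SerreTate1968, §1 Lemma 2] -/
theorem rho1_rowsMFALS_of_leg (I : RGDInputsAt F ι₁ Jstar K₀ S hU7ₛ hJ hJu Fi Kc G 𝓜 w hw h𝓨 θ e)
    (quotΩ : ∀ y, LineOf I y → AlgPoints (S.M.obj Kc) (AlgebraicClosure (w.adicCompletion F)))
    {m : ℕ}
    (E' : Matrix (Fin m) (Fin m) (𝓞 F))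
    (hE' : E' * E' = E')
    (P : Matrix (Fin m) (Fin 1) (𝓞 F))
    (y : AlgPoints (S.M.obj Kc) (AlgebraicClosure (w.adicCompletion F)))
    (L : LineOf I y)
    -- the reduced leg under TWO names tied by `hq`: `qbR` at ④-bis's RAW carrier (the row BINDERS below read it in ④-bis's own text — syntactic
    -- against `H.choose_spec`), `qb` at the SOCKET carrier (the conclusion reads it — syntactic against the socket); LA2-plan (g2) (L1)(L3)
    (qbR : haveI := I.comm; haveI : IsProper (𝓜.localise w).total.hom := h𝓨.2;
      ((I.univ.baseChange (pullback.fst (𝓜.localise w).total.hom (specResidueField w))).baseChange ((𝓜.localise w).geomReductionMap (thickeningLift e (S.M.obj Kc) y)).left).X ⟶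
        (((serreTensor I.act E' hE').baseChange (pullback.fst (𝓜.localise w).total.hom (specResidueField w))).baseChange ((𝓜.localise w).geomReductionMap (thickeningLift e (S.M.obj Kc) (quotΩ y L))).left).X)
    (qb : haveI := I.comm; (sch₀Of 𝓜 w I.univ (red₀Of S Kc 𝓜 w h𝓨 e y)).X ⟶ (sch₀Of 𝓜 w (serreTensor I.act E' hE') (red₀Of S Kc 𝓜 w h𝓨 e (quotΩ y L))).X)
    (hq : haveI := I.comm; qb = qbR)
    (hm : haveI := I.comm; haveI : IsProper (𝓜.localise w).total.hom := h𝓨.2; IsMonHom qbR)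
    (hFLAT : haveI := I.comm; haveI : IsProper (𝓜.localise w).total.hom := h𝓨.2;
      (Flat qbR.left ∧ Function.Surjective qbR.left.base))
    (hACT : haveI := I.comm; haveI : IsProper (𝓜.localise w).total.hom := h𝓨.2;
      (∀ a : 𝓞 F, ((I.act.baseChange (pullback.fst (𝓜.localise w).total.hom (specResidueField w))).baseChange ((𝓜.localise w).geomReductionMap (thickeningLift e (S.M.obj Kc) y)).left).i a ≫ qbR =
          qbR ≫ (((serreAction I.act E' hE').baseChange (pullback.fst (𝓜.localise w).total.hom (specResidueField w))).baseChange ((𝓜.localise w).geomReductionMap (thickeningLift e (S.M.obj Kc) (quotΩ y L))).left).i a))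
    (hLVL : haveI := I.comm; haveI : IsProper (𝓜.localise w).total.hom := h𝓨.2;
      (∀ a : Fin I.g ⊕ Fin I.g → ZMod I.N,
          AlgPoints.map qbR ((I.univ.baseChange (pullback.fst (𝓜.localise w).total.hom (specResidueField w))).restrictPt ((𝓜.localise w).geomReductionMap (thickeningLift e (S.M.obj Kc) y)).left
              (I.univ.sectionBaseChange (pullback.fst (𝓜.localise w).total.hom (specResidueField w)) (I.lvl.section_ a))) =
            ((serreTensor I.act E' hE').baseChange (pullback.fst (𝓜.localise w).total.hom (specResidueField w))).restrictPt ((𝓜.localise w).geomReductionMap (thickeningLift e (S.M.obj Kc) (quotΩ y L))).left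
              ((serreTensor I.act E' hE').sectionBaseChange (pullback.fst (𝓜.localise w).total.hom (specResidueField w)) (I.lvl.section_ a ≫ serreTranslate I.act E' hE' P))))
    (hSIM : haveI := I.comm; haveI : IsProper (𝓜.localise w).total.hom := h𝓨.2;
      (∀ (DBs : (((serreTensor I.act E' hE').baseChange (pullback.fst (𝓜.localise w).total.hom (specResidueField w))).baseChange ((𝓜.localise w).geomReductionMap (thickeningLift e (S.M.obj Kc) (quotΩ y L))).left).DualPair)
          (_ : Nonempty ((Scheme.Modules.pullback (DualPair.unitHatSlice DBs)).obj DBs.P ≅ SheafOfModules.unit _))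
          (lamBs : (((serreTensor I.act E' hE').baseChange (pullback.fst (𝓜.localise w).total.hom (specResidueField w))).baseChange ((𝓜.localise w).geomReductionMap (thickeningLift e (S.M.obj Kc) (quotΩ y L))).left).X ⟶ DBs.hat.X) [IsMonHom lamBs],
          (haveI := isMonHom_coverLeg (pullback.fst (𝓜.localise w).total.hom (specResidueField w)) ((𝓜.localise w).geomReductionMap (thickeningLift e (S.M.obj Kc) (quotΩ y L))).left I.act E' hE' P
           baseChangeHom (baseChangeHom (serreTranslate I.act E' hE' P) (pullback.fst (𝓜.localise w).total.hom (specResidueField w))) ((𝓜.localise w).geomReductionMap (thickeningLift e (S.M.obj Kc) (quotΩ y L))).left ≫ lamBs ≫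
              DualPair.dualIsogenyOver (baseChangeHom (baseChangeHom (serreTranslate I.act E' hE' P) (pullback.fst (𝓜.localise w).total.hom (specResidueField w))) ((𝓜.localise w).geomReductionMap (thickeningLift e (S.M.obj Kc) (quotΩ y L))).left) ((I.dual.baseChange (pullback.fst (𝓜.localise w).total.hom (specResidueField w))).baseChange ((𝓜.localise w).geomReductionMap (thickeningLift e (S.M.obj Kc) (quotΩ y L))).left) DBs =
            ((I.pol.baseChange (pullback.fst (𝓜.localise w).total.hom (specResidueField w))).baseChange ((𝓜.localise w).geomReductionMap (thickeningLift e (S.M.obj Kc) (quotΩ y L))).left).lam ≫ ((I.dual.baseChange (pullback.fst (𝓜.localise w).total.hom (specResidueField w))).baseChange ((𝓜.localise w).geomReductionMap (thickeningLift e (S.M.obj Kc) (quotΩ y L))).left).hat.mulN I.pChar) →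
          qbR ≫ lamBs ≫ DualPair.dualIsogenyOver qbR ((I.dual.baseChange (pullback.fst (𝓜.localise w).total.hom (specResidueField w))).baseChange ((𝓜.localise w).geomReductionMap (thickeningLift e (S.M.obj Kc) y)).left) DBs =
            ((I.pol.baseChange (pullback.fst (𝓜.localise w).total.hom (specResidueField w))).baseChange ((𝓜.localise w).geomReductionMap (thickeningLift e (S.M.obj Kc) y)).left).lam ≫ ((I.dual.baseChange (pullback.fst (𝓜.localise w).total.hom (specResidueField w))).baseChange ((𝓜.localise w).geomReductionMap (thickeningLift e (S.M.obj Kc) y)).left).hat.mulN I.pChar)) :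
    haveI := I.comm;
      ∃ (_ : IsMonHom qb),
        (Flat qb.left ∧ Function.Surjective qb.left.base) ∧
        (∀ a : 𝓞 F, (act₀Of 𝓜 w I.univ I.act a (red₀Of S Kc 𝓜 w h𝓨 e y)).hom.hom.hom ≫ qb =
          qb ≫ (act₀Of 𝓜 w (serreTensor I.act E' hE') (serreAction I.act E' hE') a (red₀Of S Kc 𝓜 w h𝓨 e (quotΩ y L))).hom.hom.hom) ∧
        (∀ a : Fin I.g ⊕ Fin I.g → ZMod I.N,
          AlgPoints.map qb (lvlPt₀Of 𝓜 w I.univ I.lvl (red₀Of S Kc 𝓜 w h𝓨 e y) a) =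
            ((serreTensor I.act E' hE').baseChange (pullback.fst (𝓜.localise w).total.hom (specResidueField w))).restrictPt (red₀Of S Kc 𝓜 w h𝓨 e (quotΩ y L)).left
              ((serreTensor I.act E' hE').sectionBaseChange (pullback.fst (𝓜.localise w).total.hom (specResidueField w)) (I.lvl.section_ a ≫ serreTranslate I.act E' hE' P))) ∧
        (∀ (DBs : (sch₀Of 𝓜 w (serreTensor I.act E' hE') (red₀Of S Kc 𝓜 w h𝓨 e (quotΩ y L))).DualPair)
          (_ : Nonempty ((Scheme.Modules.pullback (DualPair.unitHatSlice DBs)).obj DBs.P ≅ SheafOfModules.unit _))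
          (lamBs : (sch₀Of 𝓜 w (serreTensor I.act E' hE') (red₀Of S Kc 𝓜 w h𝓨 e (quotΩ y L))).X ⟶ DBs.hat.X) [IsMonHom lamBs],
          (haveI := isMonHom_coverLeg (pullback.fst (𝓜.localise w).total.hom (specResidueField w)) (red₀Of S Kc 𝓜 w h𝓨 e (quotΩ y L)).left I.act E' hE' P
           baseChangeHom (baseChangeHom (serreTranslate I.act E' hE' P) (pullback.fst (𝓜.localise w).total.hom (specResidueField w))) (red₀Of S Kc 𝓜 w h𝓨 e (quotΩ y L)).left ≫ lamBs ≫
              DualPair.dualIsogenyOver (baseChangeHom (baseChangeHom (serreTranslate I.act E' hE' P) (pullback.fst (𝓜.localise w).total.hom (specResidueField w))) (red₀Of S Kc 𝓜 w h𝓨 e (quotΩ y L)).left)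
                (dual₀Of 𝓜 w I.univ I.dual (red₀Of S Kc 𝓜 w h𝓨 e (quotΩ y L))) DBs =
            (pol₀Of 𝓜 w I.univ I.pol (red₀Of S Kc 𝓜 w h𝓨 e (quotΩ y L))).lam ≫ (dual₀Of 𝓜 w I.univ I.dual (red₀Of S Kc 𝓜 w h𝓨 e (quotΩ y L))).hat.mulN I.pChar) →
          qb ≫ lamBs ≫ DualPair.dualIsogenyOver qb (dual₀Of 𝓜 w I.univ I.dual (red₀Of S Kc 𝓜 w h𝓨 e y)) DBs =
            (pol₀Of 𝓜 w I.univ I.pol (red₀Of S Kc 𝓜 w h𝓨 e y)).lam ≫ (dual₀Of 𝓜 w I.univ I.dual (red₀Of S Kc 𝓜 w h𝓨 e y)).hat.mulN I.pChar) := by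
  haveI := I.comm
  haveI : IsProper (𝓜.localise w).total.hom := h𝓨.2
  subst hq
  -- (mon) THE CURE (LA1-p02 (g5) probe `RowsA.monfix`: 94.5 s → 7.0 s): the two `MonObj` instance arguments of `IsMonHom` (socket `sch₀Of`∕`red₀Of` spelling vs the
  -- leg՚s RAW `baseChange … (geomReductionMap …).left` spelling) are definitionally equal only through a deep unfolding of the transported group structure
  -- (`GrpObj.toMonObj` ∘ `baseChange` ∘ `Functor.grpObjObj` ∘ `Over.pullback` monoidal data; ≈ 52 s per object, heartbeat-free), whereas the `GrpObj` STRUCTURES themselves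
  -- compare in < 1 s (projection-lazy path).  So pin the two `GrpObj` structures by `rfl` at the socket type and rewrite them in the goal: the remaining comparison is syntactic.
  have eg : (sch₀Of 𝓜 w I.univ (red₀Of S Kc 𝓜 w h𝓨 e y)).grpObj =
      (((I.univ.baseChange (pullback.fst (𝓜.localise w).total.hom (specResidueField w))).baseChange ((𝓜.localise w).geomReductionMap (thickeningLift e (S.M.obj Kc) y)).left).grpObj : GrpObj (sch₀Of 𝓜 w I.univ (red₀Of S Kc 𝓜 w h𝓨 e y)).X) := rfl
  have eh : (sch₀Of 𝓜 w (serreTensor I.act E' hE') (red₀Of S Kc 𝓜 w h𝓨 e (quotΩ y L))).grpObj =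
      ((((serreTensor I.act E' hE').baseChange (pullback.fst (𝓜.localise w).total.hom (specResidueField w))).baseChange ((𝓜.localise w).geomReductionMap (thickeningLift e (S.M.obj Kc) (quotΩ y L))).left).grpObj : GrpObj (sch₀Of 𝓜 w (serreTensor I.act E' hE') (red₀Of S Kc 𝓜 w h𝓨 e (quotΩ y L))).X) := rfl
  have hM : IsMonHom qb := by rw [eg, eh]; exact hm
  refine ⟨hM, hFLAT, ?_, ?_, ?_⟩
  · -- (ACT): `act₀Of` IS the raw base-changed action (`rfl`)
    intro a
    exact hACT a
  · -- (LVL): `lvlPt₀Of` IS `restrictPt … ((lvl.baseChange ι_s).section_ a)`; ★ `LevelStructure.baseChange_section_`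
    intro a
    have h := hLVL a
    have e₁ := LevelStructure.baseChange_section_ (pullback.fst (𝓜.localise w).total.hom (specResidueField w)) I.lvl a
    exact (congrArg (fun s => AlgPoints.map qb
      ((I.univ.baseChange (pullback.fst (𝓜.localise w).total.hom (specResidueField w))).restrictPt (red₀Of S Kc 𝓜 w h𝓨 e y).left s)) e₁).trans h
  · -- (SIM): the (r3₀ ∀) row binder by binder
    intro DBs hDBs lamBs _ hpull
    exact hSIM DBs hDBs lamBs hpull

set_option maxHeartbeats 400000 in
set_option backward.isDefEq.respectTransparency false in
/-- **(ρ1𝒞) v6 §J ROWS A — PIECE 2∕2: (K2-gen)** («ROWSA-SPLIT», LA1-plan (g5) 2026-09-02T16:20:34Z ∕ 16:32:41Z (T1)(T2); LA1-p02 (g5)): the (K2-gen) conjunct of `rho1_rowsA_of_leg` (text VERBATIM at `ψ := qb`) from the leg's (K2₀)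
row BINDER `hK2` (text VERBATIM), through RKC `isIdealTorsionΩ_mul_of_roofLink` ∘ (r1) `_hr1`; one `subst hq`; binders pruned (no `P`, no `c`, no `hm`…`hSIM`). [cite: Liu2021, Prop. D.8 (3) p. 135, pp. 136–138] [cite: SerreTate1968, §1 Lemma 2] -/
theorem rho1_rowK2_of_leg (I : RGDInputsAt F ι₁ Jstar K₀ S hU7ₛ hJ hJu Fi Kc G 𝓜 w hw h𝓨 θ e)
    (quotΩ : ∀ y, LineOf I y → AlgPoints (S.M.obj Kc) (AlgebraicClosure (w.adicCompletion F)))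
    (translΩ : AlgPoints (S.M.obj Kc) (AlgebraicClosure (w.adicCompletion F)) → AlgPoints (S.M.obj Kc) (AlgebraicClosure (w.adicCompletion F)))
    (_hhecke : HeckeClause I quotΩ translΩ)
    (_hroof : RoofLink I quotΩ)
    (_hroof₂ : RoofLink₂ I translΩ)
    (_hunit : (UnitaryGroup.isUnit_placeForm Jstar hJu w).unit ∈ glInt 2 (w.adicCompletion F))
    (_hKc : UnitaryGroup.IsHyperspecialAt ↥(maximalRealSubfield F) F (IsCMField.complexConj F) 2 Jstar Kc.1.1
      (w.under (𝓞 ↥(maximalRealSubfield F))))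
    {m : ℕ}
    (E' : Matrix (Fin m) (Fin m) (𝓞 F))
    (hE' : E' * E' = E')
    (y : AlgPoints (S.M.obj Kc) (AlgebraicClosure (w.adicCompletion F)))
    (L : LineOf I y)
    (K : Subgroup ((fibreΩOf S Kc 𝓜 w e I.univ y).Points (AlgebraicClosure (w.adicCompletion F))))
    (_hKL : ∀ P, P ∈ L.1 ↔ P ∈ K ∧ IsIdealTorsionΩ S Kc 𝓜 w e I.univ I.act y ((IsCMField.complexConj F) • w).asIdeal P)
    (hRoof : RoofΩ S Kc 𝓜 w e I.univ I.act I.dual I.pol I.lvl I.pChar w.asIdeal y (quotΩ y L) K)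
    {B : AbelianSchemeOver (Spec (CommRingCat.of (AlgebraicClosure (w.adicCompletion F))))}
    (q : (schΩOf S Kc 𝓜 w e I.univ y).X ⟶ B.X)
    [IsMonHom q]
    (_hr1 : ∀ P : (fibreΩOf S Kc 𝓜 w e I.univ y).Points (AlgebraicClosure (w.adicCompletion F)),
        (AlgPoints.map q P : B.toAffine.toAbelianVariety.Points (AlgebraicClosure (w.adicCompletion F))) = 1 ↔ P ∈ K)
    -- the reduced leg under TWO names tied by `hq`: `qbR` at ④-bis's RAW carrier (the row BINDERS below read it in ④-bis's own text — syntactic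
    -- against `H.choose_spec`), `qb` at the SOCKET carrier (the conclusion reads it — syntactic against the socket); LA2-plan (g2) (L1)(L3)
    (qbR : haveI := I.comm; haveI : IsProper (𝓜.localise w).total.hom := h𝓨.2;
      ((I.univ.baseChange (pullback.fst (𝓜.localise w).total.hom (specResidueField w))).baseChange ((𝓜.localise w).geomReductionMap (thickeningLift e (S.M.obj Kc) y)).left).X ⟶
        (((serreTensor I.act E' hE').baseChange (pullback.fst (𝓜.localise w).total.hom (specResidueField w))).baseChange ((𝓜.localise w).geomReductionMap (thickeningLift e (S.M.obj Kc) (quotΩ y L))).left).X)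
    (qb : haveI := I.comm; (sch₀Of 𝓜 w I.univ (red₀Of S Kc 𝓜 w h𝓨 e y)).X ⟶ (sch₀Of 𝓜 w (serreTensor I.act E' hE') (red₀Of S Kc 𝓜 w h𝓨 e (quotΩ y L))).X)
    (hq : haveI := I.comm; qb = qbR)
    (hK2 : haveI := I.comm; haveI : IsProper (𝓜.localise w).total.hom := h𝓨.2;
      (∀ 𝔞 : Ideal (𝓞 F),
          (∀ Pt : ((I.univ.baseChange ((𝓜.localise w).genericIso'.inv.left ≫ pullback.fst (𝓜.localise w).total.hom (specGenericPoint (HeightOneSpectrum.valuationSubringAtPrime F w) F))).baseChange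
              (thickeningLift e (S.M.obj Kc) y).left).toAffine.toAbelianVariety.Points (AlgebraicClosure (w.adicCompletion F)),
            (AlgPoints.map q Pt : B.toAffine.toAbelianVariety.Points (AlgebraicClosure (w.adicCompletion F))) = 1 →
              ∀ r ∈ 𝔞, (AlgPoints.map (((I.act.baseChange ((𝓜.localise w).genericIso'.inv.left ≫ pullback.fst (𝓜.localise w).total.hom (specGenericPoint (HeightOneSpectrum.valuationSubringAtPrime F w) F))).baseChange (thickeningLift e (S.M.obj Kc) y).left).i r) Pt :
                ((I.univ.baseChange ((𝓜.localise w).genericIso'.inv.left ≫ pullback.fst (𝓜.localise w).total.hom (specGenericPoint (HeightOneSpectrum.valuationSubringAtPrime F w) F))).baseChange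
                  (thickeningLift e (S.M.obj Kc) y).left).toAffine.toAbelianVariety.Points (AlgebraicClosure (w.adicCompletion F))) = 1) →
          ∀ ⦃T : Over (Spec (.of (geomResidueField w)))⦄ (z : T ⟶ ((I.univ.baseChange (pullback.fst (𝓜.localise w).total.hom (specResidueField w))).baseChange ((𝓜.localise w).geomReductionMap (thickeningLift e (S.M.obj Kc) y)).left).X),
            z ≫ qbR = 1 → ∀ r ∈ 𝔞, z ≫ ((I.act.baseChange (pullback.fst (𝓜.localise w).total.hom (specResidueField w))).baseChange ((𝓜.localise w).geomReductionMap (thickeningLift e (S.M.obj Kc) y)).left).i r = 1)) :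
    haveI := I.comm;
        (∀ 𝔞 : Ideal (𝓞 F), (∀ Pt ∈ L.1, IsIdealTorsionΩ S Kc 𝓜 w e I.univ I.act y 𝔞 Pt) →
          (∀ Pt : (fibreΩOf S Kc 𝓜 w e I.univ y).Points (AlgebraicClosure (w.adicCompletion F)),
            (∀ r ∈ w.asIdeal * ((IsCMField.complexConj F) • w).asIdeal, (AlgPoints.map (actΩOf S Kc 𝓜 w e I.univ I.act r y).hom.hom.hom Pt :
              (fibreΩOf S Kc 𝓜 w e I.univ y).Points (AlgebraicClosure (w.adicCompletion F))) = 1) → IsIdealTorsionΩ S Kc 𝓜 w e I.univ I.act y 𝔞 Pt) →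
          ∀ ⦃T : SchemeOver (geomResidueField w)⦄ (z : T ⟶ (sch₀Of 𝓜 w I.univ (red₀Of S Kc 𝓜 w h𝓨 e y)).X),
            z ≫ qb = 1 → ∀ r ∈ 𝔞, z ≫ (act₀Of 𝓜 w I.univ I.act r (red₀Of S Kc 𝓜 w h𝓨 e y)).hom.hom.hom = 1) := by
  haveI := I.comm
  haveI : IsProper (𝓜.localise w).total.hom := h𝓨.2
  subst hq
  -- the roof kernel is `𝔭_w·𝔭_{c•w}`-torsion (served RKC; `I.hunr`)
  have hKtors := isIdealTorsionΩ_mul_of_roofLink I quotΩ translΩ _hhecke _hunit _hKc _hroof _hroof₂ I.hunr y L K ⟨_hKL, hRoof⟩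
  -- (K2-gen): RKC torsion ∘ (r1) ∘ (K2₀); the RAW instance is built WITHOUT expected type (`have`), then matched (probe: 191 k → 154 k heartbeats, 45 s → 35 s)
  intro 𝔞 _ hgen
  have hraw := hK2 𝔞 (fun Pt hPt r hr => hgen Pt (hKtors Pt ((_hr1 Pt).1 hPt)) r hr)
  exact hraw

set_option maxHeartbeats 400000 in
set_option backward.isDefEq.respectTransparency false in
/-- **(ρ1𝒞) v6 §J ROWS A — (mon)(FLAT-SURJ)(ACT)(LVL)(SIM)(K2-gen) IN BINDER FORM** (binders pruned to what the five rows read): for the reduced leg with its rows (r1₀)(r4₀)(r5₀)(r3₀ ∀)(K2₀) as BINDERS (④-bis's conjunct texts VERBATIM at `qbR`), the socket's first five conjuncts VERBATIM at `ψ := qb` under `∃ (_ : IsMonHom ψ)` (the socket's own shape); (K2-gen) through RKC `isIdealTorsionΩ_mul_of_roofLink` ∘ (r1).  (LA1-plan (g5) 13:43:24Z (a); LA2-plan (g2) 14:20:43Z (L1)–(L3).) [cite: Liu2021, Prop. D.8 (3) p. 135, pp. 136–138] [cite: SerreTate1968, §1 Lemma 2] -/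
theorem rho1_rowsA_of_leg (I : RGDInputsAt F ι₁ Jstar K₀ S hU7ₛ hJ hJu Fi Kc G 𝓜 w hw h𝓨 θ e)
    (quotΩ : ∀ y, LineOf I y → AlgPoints (S.M.obj Kc) (AlgebraicClosure (w.adicCompletion F)))
    (translΩ : AlgPoints (S.M.obj Kc) (AlgebraicClosure (w.adicCompletion F)) → AlgPoints (S.M.obj Kc) (AlgebraicClosure (w.adicCompletion F)))
    (_hhecke : HeckeClause I quotΩ translΩ)
    (_hroof : RoofLink I quotΩ)
    (_hroof₂ : RoofLink₂ I translΩ)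
    (_hunit : (UnitaryGroup.isUnit_placeForm Jstar hJu w).unit ∈ glInt 2 (w.adicCompletion F))
    (_hKc : UnitaryGroup.IsHyperspecialAt ↥(maximalRealSubfield F) F (IsCMField.complexConj F) 2 Jstar Kc.1.1
      (w.under (𝓞 ↥(maximalRealSubfield F))))
    {m : ℕ}
    (E' : Matrix (Fin m) (Fin m) (𝓞 F))
    (hE' : E' * E' = E')
    (P : Matrix (Fin m) (Fin 1) (𝓞 F))
    (y : AlgPoints (S.M.obj Kc) (AlgebraicClosure (w.adicCompletion F)))
    (L : LineOf I y)
    (K : Subgroup ((fibreΩOf S Kc 𝓜 w e I.univ y).Points (AlgebraicClosure (w.adicCompletion F))))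
    (_hKL : ∀ P, P ∈ L.1 ↔ P ∈ K ∧ IsIdealTorsionΩ S Kc 𝓜 w e I.univ I.act y ((IsCMField.complexConj F) • w).asIdeal P)
    (hRoof : RoofΩ S Kc 𝓜 w e I.univ I.act I.dual I.pol I.lvl I.pChar w.asIdeal y (quotΩ y L) K)
    {B : AbelianSchemeOver (Spec (CommRingCat.of (AlgebraicClosure (w.adicCompletion F))))}
    (q : (schΩOf S Kc 𝓜 w e I.univ y).X ⟶ B.X)
    [IsMonHom q]
    (c : (schΩOf S Kc 𝓜 w e I.univ (quotΩ y L)).X ⟶ B.X)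
    [IsMonHom c]
    (_hr1 : ∀ P : (fibreΩOf S Kc 𝓜 w e I.univ y).Points (AlgebraicClosure (w.adicCompletion F)),
        (AlgPoints.map q P : B.toAffine.toAbelianVariety.Points (AlgebraicClosure (w.adicCompletion F))) = 1 ↔ P ∈ K)
    -- the reduced leg under TWO names tied by `hq`: `qbR` at ④-bis's RAW carrier (the row BINDERS below read it in ④-bis's own text — syntactic
    -- against `H.choose_spec`), `qb` at the SOCKET carrier (the conclusion reads it — syntactic against the socket); LA2-plan (g2) (L1)(L3)
    (qbR : haveI := I.comm; haveI : IsProper (𝓜.localise w).total.hom := h𝓨.2;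
      ((I.univ.baseChange (pullback.fst (𝓜.localise w).total.hom (specResidueField w))).baseChange ((𝓜.localise w).geomReductionMap (thickeningLift e (S.M.obj Kc) y)).left).X ⟶
        (((serreTensor I.act E' hE').baseChange (pullback.fst (𝓜.localise w).total.hom (specResidueField w))).baseChange ((𝓜.localise w).geomReductionMap (thickeningLift e (S.M.obj Kc) (quotΩ y L))).left).X)
    (qb : haveI := I.comm; (sch₀Of 𝓜 w I.univ (red₀Of S Kc 𝓜 w h𝓨 e y)).X ⟶ (sch₀Of 𝓜 w (serreTensor I.act E' hE') (red₀Of S Kc 𝓜 w h𝓨 e (quotΩ y L))).X)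
    (hq : haveI := I.comm; qb = qbR)
    (hm : haveI := I.comm; haveI : IsProper (𝓜.localise w).total.hom := h𝓨.2; IsMonHom qbR)
    (hFLAT : haveI := I.comm; haveI : IsProper (𝓜.localise w).total.hom := h𝓨.2;
      (Flat qbR.left ∧ Function.Surjective qbR.left.base))
    (hACT : haveI := I.comm; haveI : IsProper (𝓜.localise w).total.hom := h𝓨.2;
      (∀ a : 𝓞 F, ((I.act.baseChange (pullback.fst (𝓜.localise w).total.hom (specResidueField w))).baseChange ((𝓜.localise w).geomReductionMap (thickeningLift e (S.M.obj Kc) y)).left).i a ≫ qbR =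
          qbR ≫ (((serreAction I.act E' hE').baseChange (pullback.fst (𝓜.localise w).total.hom (specResidueField w))).baseChange ((𝓜.localise w).geomReductionMap (thickeningLift e (S.M.obj Kc) (quotΩ y L))).left).i a))
    (hLVL : haveI := I.comm; haveI : IsProper (𝓜.localise w).total.hom := h𝓨.2;
      (∀ a : Fin I.g ⊕ Fin I.g → ZMod I.N,
          AlgPoints.map qbR ((I.univ.baseChange (pullback.fst (𝓜.localise w).total.hom (specResidueField w))).restrictPt ((𝓜.localise w).geomReductionMap (thickeningLift e (S.M.obj Kc) y)).left
              (I.univ.sectionBaseChange (pullback.fst (𝓜.localise w).total.hom (specResidueField w)) (I.lvl.section_ a))) =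
            ((serreTensor I.act E' hE').baseChange (pullback.fst (𝓜.localise w).total.hom (specResidueField w))).restrictPt ((𝓜.localise w).geomReductionMap (thickeningLift e (S.M.obj Kc) (quotΩ y L))).left
              ((serreTensor I.act E' hE').sectionBaseChange (pullback.fst (𝓜.localise w).total.hom (specResidueField w)) (I.lvl.section_ a ≫ serreTranslate I.act E' hE' P))))
    (hSIM : haveI := I.comm; haveI : IsProper (𝓜.localise w).total.hom := h𝓨.2;
      (∀ (DBs : (((serreTensor I.act E' hE').baseChange (pullback.fst (𝓜.localise w).total.hom (specResidueField w))).baseChange ((𝓜.localise w).geomReductionMap (thickeningLift e (S.M.obj Kc) (quotΩ y L))).left).DualPair)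
          (_ : Nonempty ((Scheme.Modules.pullback (DualPair.unitHatSlice DBs)).obj DBs.P ≅ SheafOfModules.unit _))
          (lamBs : (((serreTensor I.act E' hE').baseChange (pullback.fst (𝓜.localise w).total.hom (specResidueField w))).baseChange ((𝓜.localise w).geomReductionMap (thickeningLift e (S.M.obj Kc) (quotΩ y L))).left).X ⟶ DBs.hat.X) [IsMonHom lamBs],
          (haveI := isMonHom_coverLeg (pullback.fst (𝓜.localise w).total.hom (specResidueField w)) ((𝓜.localise w).geomReductionMap (thickeningLift e (S.M.obj Kc) (quotΩ y L))).left I.act E' hE' P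
           baseChangeHom (baseChangeHom (serreTranslate I.act E' hE' P) (pullback.fst (𝓜.localise w).total.hom (specResidueField w))) ((𝓜.localise w).geomReductionMap (thickeningLift e (S.M.obj Kc) (quotΩ y L))).left ≫ lamBs ≫
              DualPair.dualIsogenyOver (baseChangeHom (baseChangeHom (serreTranslate I.act E' hE' P) (pullback.fst (𝓜.localise w).total.hom (specResidueField w))) ((𝓜.localise w).geomReductionMap (thickeningLift e (S.M.obj Kc) (quotΩ y L))).left) ((I.dual.baseChange (pullback.fst (𝓜.localise w).total.hom (specResidueField w))).baseChange ((𝓜.localise w).geomReductionMap (thickeningLift e (S.M.obj Kc) (quotΩ y L))).left) DBs =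
            ((I.pol.baseChange (pullback.fst (𝓜.localise w).total.hom (specResidueField w))).baseChange ((𝓜.localise w).geomReductionMap (thickeningLift e (S.M.obj Kc) (quotΩ y L))).left).lam ≫ ((I.dual.baseChange (pullback.fst (𝓜.localise w).total.hom (specResidueField w))).baseChange ((𝓜.localise w).geomReductionMap (thickeningLift e (S.M.obj Kc) (quotΩ y L))).left).hat.mulN I.pChar) →
          qbR ≫ lamBs ≫ DualPair.dualIsogenyOver qbR ((I.dual.baseChange (pullback.fst (𝓜.localise w).total.hom (specResidueField w))).baseChange ((𝓜.localise w).geomReductionMap (thickeningLift e (S.M.obj Kc) y)).left) DBs =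
            ((I.pol.baseChange (pullback.fst (𝓜.localise w).total.hom (specResidueField w))).baseChange ((𝓜.localise w).geomReductionMap (thickeningLift e (S.M.obj Kc) y)).left).lam ≫ ((I.dual.baseChange (pullback.fst (𝓜.localise w).total.hom (specResidueField w))).baseChange ((𝓜.localise w).geomReductionMap (thickeningLift e (S.M.obj Kc) y)).left).hat.mulN I.pChar))
    (hK2 : haveI := I.comm; haveI : IsProper (𝓜.localise w).total.hom := h𝓨.2;
      (∀ 𝔞 : Ideal (𝓞 F),
          (∀ Pt : ((I.univ.baseChange ((𝓜.localise w).genericIso'.inv.left ≫ pullback.fst (𝓜.localise w).total.hom (specGenericPoint (HeightOneSpectrum.valuationSubringAtPrime F w) F))).baseChange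
              (thickeningLift e (S.M.obj Kc) y).left).toAffine.toAbelianVariety.Points (AlgebraicClosure (w.adicCompletion F)),
            (AlgPoints.map q Pt : B.toAffine.toAbelianVariety.Points (AlgebraicClosure (w.adicCompletion F))) = 1 →
              ∀ r ∈ 𝔞, (AlgPoints.map (((I.act.baseChange ((𝓜.localise w).genericIso'.inv.left ≫ pullback.fst (𝓜.localise w).total.hom (specGenericPoint (HeightOneSpectrum.valuationSubringAtPrime F w) F))).baseChange (thickeningLift e (S.M.obj Kc) y).left).i r) Pt :
                ((I.univ.baseChange ((𝓜.localise w).genericIso'.inv.left ≫ pullback.fst (𝓜.localise w).total.hom (specGenericPoint (HeightOneSpectrum.valuationSubringAtPrime F w) F))).baseChange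
                  (thickeningLift e (S.M.obj Kc) y).left).toAffine.toAbelianVariety.Points (AlgebraicClosure (w.adicCompletion F))) = 1) →
          ∀ ⦃T : Over (Spec (.of (geomResidueField w)))⦄ (z : T ⟶ ((I.univ.baseChange (pullback.fst (𝓜.localise w).total.hom (specResidueField w))).baseChange ((𝓜.localise w).geomReductionMap (thickeningLift e (S.M.obj Kc) y)).left).X),
            z ≫ qbR = 1 → ∀ r ∈ 𝔞, z ≫ ((I.act.baseChange (pullback.fst (𝓜.localise w).total.hom (specResidueField w))).baseChange ((𝓜.localise w).geomReductionMap (thickeningLift e (S.M.obj Kc) y)).left).i r = 1)) :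
    haveI := I.comm;
      ∃ (_ : IsMonHom qb),
        (Flat qb.left ∧ Function.Surjective qb.left.base) ∧
        (∀ a : 𝓞 F, (act₀Of 𝓜 w I.univ I.act a (red₀Of S Kc 𝓜 w h𝓨 e y)).hom.hom.hom ≫ qb =
          qb ≫ (act₀Of 𝓜 w (serreTensor I.act E' hE') (serreAction I.act E' hE') a (red₀Of S Kc 𝓜 w h𝓨 e (quotΩ y L))).hom.hom.hom) ∧
        (∀ a : Fin I.g ⊕ Fin I.g → ZMod I.N,
          AlgPoints.map qb (lvlPt₀Of 𝓜 w I.univ I.lvl (red₀Of S Kc 𝓜 w h𝓨 e y) a) =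
            ((serreTensor I.act E' hE').baseChange (pullback.fst (𝓜.localise w).total.hom (specResidueField w))).restrictPt (red₀Of S Kc 𝓜 w h𝓨 e (quotΩ y L)).left
              ((serreTensor I.act E' hE').sectionBaseChange (pullback.fst (𝓜.localise w).total.hom (specResidueField w)) (I.lvl.section_ a ≫ serreTranslate I.act E' hE' P))) ∧
        (∀ (DBs : (sch₀Of 𝓜 w (serreTensor I.act E' hE') (red₀Of S Kc 𝓜 w h𝓨 e (quotΩ y L))).DualPair)
          (_ : Nonempty ((Scheme.Modules.pullback (DualPair.unitHatSlice DBs)).obj DBs.P ≅ SheafOfModules.unit _))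
          (lamBs : (sch₀Of 𝓜 w (serreTensor I.act E' hE') (red₀Of S Kc 𝓜 w h𝓨 e (quotΩ y L))).X ⟶ DBs.hat.X) [IsMonHom lamBs],
          (haveI := isMonHom_coverLeg (pullback.fst (𝓜.localise w).total.hom (specResidueField w)) (red₀Of S Kc 𝓜 w h𝓨 e (quotΩ y L)).left I.act E' hE' P
           baseChangeHom (baseChangeHom (serreTranslate I.act E' hE' P) (pullback.fst (𝓜.localise w).total.hom (specResidueField w))) (red₀Of S Kc 𝓜 w h𝓨 e (quotΩ y L)).left ≫ lamBs ≫
              DualPair.dualIsogenyOver (baseChangeHom (baseChangeHom (serreTranslate I.act E' hE' P) (pullback.fst (𝓜.localise w).total.hom (specResidueField w))) (red₀Of S Kc 𝓜 w h𝓨 e (quotΩ y L)).left)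
                (dual₀Of 𝓜 w I.univ I.dual (red₀Of S Kc 𝓜 w h𝓨 e (quotΩ y L))) DBs =
            (pol₀Of 𝓜 w I.univ I.pol (red₀Of S Kc 𝓜 w h𝓨 e (quotΩ y L))).lam ≫ (dual₀Of 𝓜 w I.univ I.dual (red₀Of S Kc 𝓜 w h𝓨 e (quotΩ y L))).hat.mulN I.pChar) →
          qb ≫ lamBs ≫ DualPair.dualIsogenyOver qb (dual₀Of 𝓜 w I.univ I.dual (red₀Of S Kc 𝓜 w h𝓨 e y)) DBs =
            (pol₀Of 𝓜 w I.univ I.pol (red₀Of S Kc 𝓜 w h𝓨 e y)).lam ≫ (dual₀Of 𝓜 w I.univ I.dual (red₀Of S Kc 𝓜 w h𝓨 e y)).hat.mulN I.pChar) ∧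
        (∀ 𝔞 : Ideal (𝓞 F), (∀ Pt ∈ L.1, IsIdealTorsionΩ S Kc 𝓜 w e I.univ I.act y 𝔞 Pt) →
          (∀ Pt : (fibreΩOf S Kc 𝓜 w e I.univ y).Points (AlgebraicClosure (w.adicCompletion F)),
            (∀ r ∈ w.asIdeal * ((IsCMField.complexConj F) • w).asIdeal, (AlgPoints.map (actΩOf S Kc 𝓜 w e I.univ I.act r y).hom.hom.hom Pt :
              (fibreΩOf S Kc 𝓜 w e I.univ y).Points (AlgebraicClosure (w.adicCompletion F))) = 1) → IsIdealTorsionΩ S Kc 𝓜 w e I.univ I.act y 𝔞 Pt) →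
          ∀ ⦃T : SchemeOver (geomResidueField w)⦄ (z : T ⟶ (sch₀Of 𝓜 w I.univ (red₀Of S Kc 𝓜 w h𝓨 e y)).X),
            z ≫ qb = 1 → ∀ r ∈ 𝔞, z ≫ (act₀Of 𝓜 w I.univ I.act r (red₀Of S Kc 𝓜 w h𝓨 e y)).hom.hom.hom = 1) := by
  -- «ROWSA-SPLIT» (LA1-plan (g5) 2026-09-02T16:20:34Z ∕ (T1)(T2) 16:32:41Z; LA1-p02 (g5)): SIGNATURE BYTES UNCHANGED (draft 10 :1019–:1110); body = the two
  -- row-group pieces re-assembled by projections only — no `subst`, no RAW∕socket transport in THIS decl (those live in the pieces)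
  haveI := I.comm
  have hA := rho1_rowsMFALS_of_leg I quotΩ E' hE' P y L qbR qb hq hm hFLAT hACT hLVL hSIM
  have hK := rho1_rowK2_of_leg I quotΩ translΩ _hhecke _hroof _hroof₂ _hunit _hKc E' hE' y L K _hKL hRoof q _hr1 qbR qb hq hK2
  exact ⟨hA.fst, hA.snd.1, hA.snd.2.1, hA.snd.2.2.1, hA.snd.2.2.2, hK⟩

set_option maxHeartbeats 400000 in
set_option backward.isDefEq.respectTransparency false in
/-- **(ρ1𝒞) v6 §J ROW (RK) IN BINDER FORM** (v5 hole 1∕4; binders pruned): the socket's (RK) conjunct at `ψ := qb` from the leg's (RK₀) row — `rk_row_of_kerRow` ∘ RKC `natCard_roofKernel_eq`. [cite: Liu2021, Prop. D.8 (3) p. 135, pp. 136–138] [cite: SerreTate1968, §1 Lemma 2] [cite: Tate1997FiniteFlatGroupSchemes, (3.7)] -/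
theorem rho1_rowRK_of_leg (I : RGDInputsAt F ι₁ Jstar K₀ S hU7ₛ hJ hJu Fi Kc G 𝓜 w hw h𝓨 θ e)
    (quotΩ : ∀ y, LineOf I y → AlgPoints (S.M.obj Kc) (AlgebraicClosure (w.adicCompletion F)))
    (translΩ : AlgPoints (S.M.obj Kc) (AlgebraicClosure (w.adicCompletion F)) → AlgPoints (S.M.obj Kc) (AlgebraicClosure (w.adicCompletion F)))
    (_hhecke : HeckeClause I quotΩ translΩ)
    (_hroof : RoofLink I quotΩ)
    (_hroof₂ : RoofLink₂ I translΩ)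
    (_hunit : (UnitaryGroup.isUnit_placeForm Jstar hJu w).unit ∈ glInt 2 (w.adicCompletion F))
    (_hKc : UnitaryGroup.IsHyperspecialAt ↥(maximalRealSubfield F) F (IsCMField.complexConj F) 2 Jstar Kc.1.1
      (w.under (𝓞 ↥(maximalRealSubfield F))))
    {m : ℕ}
    (E' : Matrix (Fin m) (Fin m) (𝓞 F))
    (hE' : E' * E' = E')
    (y : AlgPoints (S.M.obj Kc) (AlgebraicClosure (w.adicCompletion F)))
    (L : LineOf I y)
    (K : Subgroup ((fibreΩOf S Kc 𝓜 w e I.univ y).Points (AlgebraicClosure (w.adicCompletion F))))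
    (_hKL : ∀ P, P ∈ L.1 ↔ P ∈ K ∧ IsIdealTorsionΩ S Kc 𝓜 w e I.univ I.act y ((IsCMField.complexConj F) • w).asIdeal P)
    (hRoof : RoofΩ S Kc 𝓜 w e I.univ I.act I.dual I.pol I.lvl I.pChar w.asIdeal y (quotΩ y L) K)
    {B : AbelianSchemeOver (Spec (CommRingCat.of (AlgebraicClosure (w.adicCompletion F))))}
    (q : (schΩOf S Kc 𝓜 w e I.univ y).X ⟶ B.X)
    [IsMonHom q]
    (_hr1 : ∀ P : (fibreΩOf S Kc 𝓜 w e I.univ y).Points (AlgebraicClosure (w.adicCompletion F)),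
        (AlgPoints.map q P : B.toAffine.toAbelianVariety.Points (AlgebraicClosure (w.adicCompletion F))) = 1 ↔ P ∈ K)
    -- the reduced leg under TWO names tied by `hq`: `qbR` at ④-bis's RAW carrier (the row BINDERS below read it in ④-bis's own text — syntactic
    -- against `H.choose_spec`), `qb` at the SOCKET carrier (the conclusion reads it — syntactic against the socket); LA2-plan (g2) (L1)(L3)
    (qbR : haveI := I.comm; haveI : IsProper (𝓜.localise w).total.hom := h𝓨.2;
      ((I.univ.baseChange (pullback.fst (𝓜.localise w).total.hom (specResidueField w))).baseChange ((𝓜.localise w).geomReductionMap (thickeningLift e (S.M.obj Kc) y)).left).X ⟶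
        (((serreTensor I.act E' hE').baseChange (pullback.fst (𝓜.localise w).total.hom (specResidueField w))).baseChange ((𝓜.localise w).geomReductionMap (thickeningLift e (S.M.obj Kc) (quotΩ y L))).left).X)
    (qb : haveI := I.comm; (sch₀Of 𝓜 w I.univ (red₀Of S Kc 𝓜 w h𝓨 e y)).X ⟶ (sch₀Of 𝓜 w (serreTensor I.act E' hE') (red₀Of S Kc 𝓜 w h𝓨 e (quotΩ y L))).X)
    (hq : haveI := I.comm; qb = qbR)
    (hRK : haveI := I.comm; haveI : IsProper (𝓜.localise w).total.hom := h𝓨.2;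
      Module.finrank (geomResidueField w) (Literature.AlgebraicGeometry.GroupSchemes.AffineGroupScheme.Alg (Literature.AlgebraicGeometry.GroupSchemes.GroupSchemeKernel.ker qbR)) =
          Nat.card (Literature.AlgebraicGeometry.Motives.AbelianVariety.Hom.kerPoints (specOver (AlgebraicClosure (w.adicCompletion F)) (AlgebraicClosure (w.adicCompletion F))) (homOfIsMonHom q))) :
    haveI := I.comm;
      (∀ (K : SchemeOver (geomResidueField w)) [GrpObj K] [IsAffine K.left] [Module.Finite (geomResidueField w) (Alg K)]
          (κ : K ⟶ (sch₀Of 𝓜 w I.univ (red₀Of S Kc 𝓜 w h𝓨 e y)).X) [IsMonHom κ] [IsClosedImmersion κ.left],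
          (∀ ⦃T : SchemeOver (geomResidueField w)⦄ (t : T ⟶ (sch₀Of 𝓜 w I.univ (red₀Of S Kc 𝓜 w h𝓨 e y)).X), (∃ s : T ⟶ K, s ≫ κ = t) ↔ t ≫ qb = 1) →
          Module.finrank (geomResidueField w) (Alg K) = I.pChar ^ I.fDeg * I.pChar ^ I.fDeg) := by
  haveI := I.comm
  haveI : IsProper (𝓜.localise w).total.hom := h𝓨.2
  subst hq
  have hcardK := natCard_roofKernel_eq I quotΩ translΩ _hhecke _hunit _hKc _hroof _hroof₂ y L K ⟨_hKL, hRoof⟩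
  exact rk_row_of_kerRow I E' hE' y (quotΩ y L) q K _hr1 hcardK qb hRK

set_option maxHeartbeats 400000 in
set_option backward.isDefEq.respectTransparency false in
/-- **(ρ1𝒞) v6 §J ROW (KILL) IN BINDER FORM** (v5 hole 2∕4; binders pruned): the socket's (KILL) conjunct at `ψ := qb` from the leg's (K3₀) row — `kill_row_of_kerRow_sigma` (served (KE) HEAD-K) with the (F1) pins `sigma_pins`. [cite: Liu2021, Prop. D.8 (3) p. 135, pp. 136–138] [cite: SerreTate1968, §1 Lemma 2] -/
theorem rho1_rowKILL_of_leg (I : RGDInputsAt F ι₁ Jstar K₀ S hU7ₛ hJ hJu Fi Kc G 𝓜 w hw h𝓨 θ e)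
    [ExpChar (geomResidueField w) I.pChar]
    (𝔡 : ∀ xbar, DockAt I xbar)
    (quotΩ : ∀ y, LineOf I y → AlgPoints (S.M.obj Kc) (AlgebraicClosure (w.adicCompletion F)))
    {m : ℕ}
    (E' : Matrix (Fin m) (Fin m) (𝓞 F))
    (hE' : E' * E' = E')
    (y : AlgPoints (S.M.obj Kc) (AlgebraicClosure (w.adicCompletion F)))
    (L : LineOf I y)
    (K : Subgroup ((fibreΩOf S Kc 𝓜 w e I.univ y).Points (AlgebraicClosure (w.adicCompletion F))))
    (_hKL : ∀ P, P ∈ L.1 ↔ P ∈ K ∧ IsIdealTorsionΩ S Kc 𝓜 w e I.univ I.act y ((IsCMField.complexConj F) • w).asIdeal P)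
    {B : AbelianSchemeOver (Spec (CommRingCat.of (AlgebraicClosure (w.adicCompletion F))))}
    (q : (schΩOf S Kc 𝓜 w e I.univ y).X ⟶ B.X)
    [IsMonHom q]
    (_hr1 : ∀ P : (fibreΩOf S Kc 𝓜 w e I.univ y).Points (AlgebraicClosure (w.adicCompletion F)),
        (AlgPoints.map q P : B.toAffine.toAbelianVariety.Points (AlgebraicClosure (w.adicCompletion F))) = 1 ↔ P ∈ K)
    -- the reduced leg under TWO names tied by `hq`: `qbR` at ④-bis's RAW carrier (the row BINDERS below read it in ④-bis's own text — syntactic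
    -- against `H.choose_spec`), `qb` at the SOCKET carrier (the conclusion reads it — syntactic against the socket); LA2-plan (g2) (L1)(L3)
    (qbR : haveI := I.comm; haveI : IsProper (𝓜.localise w).total.hom := h𝓨.2;
      ((I.univ.baseChange (pullback.fst (𝓜.localise w).total.hom (specResidueField w))).baseChange ((𝓜.localise w).geomReductionMap (thickeningLift e (S.M.obj Kc) y)).left).X ⟶
        (((serreTensor I.act E' hE').baseChange (pullback.fst (𝓜.localise w).total.hom (specResidueField w))).baseChange ((𝓜.localise w).geomReductionMap (thickeningLift e (S.M.obj Kc) (quotΩ y L))).left).X)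
    (qb : haveI := I.comm; (sch₀Of 𝓜 w I.univ (red₀Of S Kc 𝓜 w h𝓨 e y)).X ⟶ (sch₀Of 𝓜 w (serreTensor I.act E' hE') (red₀Of S Kc 𝓜 w h𝓨 e (quotΩ y L))).X)
    (hq : haveI := I.comm; qb = qbR)
    (hK3 : haveI := I.comm; haveI : IsProper (𝓜.localise w).total.hom := h𝓨.2;
      (∀ (𝒦 : Over (Spec (.of (closureValuationSubring (w.adicCompletion F))))) (incl : 𝒦 ⟶ (I.univ.baseChange (extendPoint (closureValuationSubring (w.adicCompletion F)) (toClosureValuationSubring w) (𝓜.localise w).total ((𝓜.localise w).modelPointsEquiv.symm (thickeningLift e (S.M.obj Kc) y))).left).X) [Flat 𝒦.hom],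
          ((Over.pullback (specFractionFieldι (closureValuationSubring (w.adicCompletion F)) (toClosureValuationSubring w)).left).map incl ≫
              (I.univ.fibreBaseChangeIso ((𝓜.localise w).genericIso'.inv.left ≫ pullback.fst (𝓜.localise w).total.hom (specGenericPoint (HeightOneSpectrum.valuationSubringAtPrime F w) F)) (thickeningLift e (S.M.obj Kc) y).left ≪≫ I.univ.fibreCongrPtIso ((𝓜.localise w).left_specFractionFieldι_comp_extendPoint_modelPointsEquiv_symm (thickeningLift e (S.M.obj Kc) y)).symm ≪≫ (I.univ.fibreBaseChangeIso (extendPoint (closureValuationSubring (w.adicCompletion F)) (toClosureValuationSubring w) (𝓜.localise w).total ((𝓜.localise w).modelPointsEquiv.symm (thickeningLift e (S.M.obj Kc) y))).left (specFractionFieldι (closureValuationSubring (w.adicCompletion F)) (toClosureValuationSubring w)).left).symm).inv.hom.hom.hom) ≫ q = 1 →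
          ((Over.pullback ((geomClosedPointIsoSpecResidueField w).inv.left ≫ (specRingHomι (closureValuationSubring (w.adicCompletion F)) (toClosureValuationSubring w) (IsLocalRing.residue (closureValuationSubring (w.adicCompletion F)))).left)).map incl ≫
              (I.univ.fibreBaseChangeIso (pullback.fst (𝓜.localise w).total.hom (specResidueField w)) ((𝓜.localise w).geomReductionMap (thickeningLift e (S.M.obj Kc) y)).left ≪≫ I.univ.fibreCongrPtIso (((𝓜.localise w).left_geomReductionMap_comp_fst (thickeningLift e (S.M.obj Kc) y)).trans (Category.assoc _ _ _).symm) ≪≫ (I.univ.fibreBaseChangeIso (extendPoint (closureValuationSubring (w.adicCompletion F)) (toClosureValuationSubring w) (𝓜.localise w).total ((𝓜.localise w).modelPointsEquiv.symm (thickeningLift e (S.M.obj Kc) y))).left ((geomClosedPointIsoSpecResidueField w).inv.left ≫ (specRingHomι (closureValuationSubring (w.adicCompletion F)) (toClosureValuationSubring w) (IsLocalRing.residue (closureValuationSubring (w.adicCompletion F)))).left)).symm).inv.hom.hom.hom) ≫ qbR = 1)) :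
    haveI := I.comm;
    letI := (𝔡 (red₀Of S Kc 𝓜 w h𝓨 e y)).grp₀;
    haveI := (𝔡 (red₀Of S Kc 𝓜 w h𝓨 e y)).aff₀;
      quotIncl (𝔡 (red₀Of S Kc 𝓜 w h𝓨 e y)).G₀ (spGeoOf I 𝔡 y L).1 ≫ (𝔡 (red₀Of S Kc 𝓜 w h𝓨 e y)).ι₀G ≫ qb = 1 := by
  haveI := I.comm
  haveI : IsProper (𝓜.localise w).total.hom := h𝓨.2
  letI := (𝔡 (red₀Of S Kc 𝓜 w h𝓨 e y)).grp₀
  haveI := (𝔡 (red₀Of S Kc 𝓜 w h𝓨 e y)).aff₀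
  subst hq
  have hσ := sigma_pins I y
  exact kill_row_of_kerRow_sigma I 𝔡 E' hE' y (quotΩ y L) L q K _hKL _hr1 qb hσ.1 hσ.2 hK3

end Rho1Head

end Summit.HodgeConjecture.HodgeConjecture.Cruxes.HLiu418.F0P6aLineSpecialisation

end
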